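import Literature.Topology.FourManifolds.ArcClosing
import Mathlib.Geometry.Manifold.SmoothEmbedding
import Mathlib.Geometry.Manifold.ContMDiffMFDeriv
import Mathlib.Analysis.SpecialFunctions.Trigonometric.ArctanDeriv
import HarnessLib

/-!
# A normal arc through a point of a compact embedded submanifold, and dual circles
# (Budney–Gabai Thm. 3.13, first step of the proof)

Topic `Literature/Topology/FourManifolds`; general infrastructure for the fact seat of
`Literature.Topology.FourManifolds.BudneyGabai2019_thm_3_13` (`NonSeparatingSpheres.lean`:
`Diff(S¹ × Sⁿ)` acts transitively on the non-separating `n`-spheres of `S¹ × Sⁿ`; R. Budney,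
D. Gabai, *Knotted 3-balls in `S⁴`*, arXiv:1912.09029, Thm. 3.13).  The printed proof begins
(p. 22): *"observe that complementary to a non-separating sphere there is an embedding
`S¹ → S¹ × Sⁿ` that intersects the sphere precisely once and transversely."*  Such a **dual
circle** is obtained by closing up a short arc crossing the sphere once; this file constructs the
arc in general and closes it up with the tree's arc-closing theorem
(`Milnor1965_exists_embedding_circle_through_arc_holds`, `ArcClosing.lean`: Milnor 1965, proof of
Lemma 8.3 with Whitney's Lemma 6.12).  **Everything here is proved; no definition and no named
fact is introduced.**

* `exists_normalArc_of_isSmoothEmbedding` — **normal arcs.**  Let `f : M → N` be a `C^∞`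
  embedding (Mathlib `Manifold.IsSmoothEmbedding`) of a compact manifold into a Hausdorff
  manifold of larger dimension (boundaryless finite-dimensional real models `I`, `J`).  Through
  every point `f x₀` there is a `C^∞` injective immersion `γ : ℝ → N` with `γ 0 = f x₀`, meeting
  `f(M)` **only** at `γ 0`, and **transversally**: `γ'(0) ∉ df_{x₀}(T_{x₀} M)`.  Proof: in the
  slice charts `φ`, `ψ` of the immersion at `x₀` (Mathlib `IsImmersionAt.domChart/codChart`,
  `writtenInCharts`: `ψ ∘ f ∘ φ⁻¹ = L ∘ (·, 0)` for a linear isomorphism `L : E × F ≅ E'`), take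
  the straight segment `r ↦ ψ⁻¹(ψ(f x₀) + r v)` in a direction `v ∉ L(E × 0)` (which exists as
  `dim E < dim E'`).  A point `f y` on it with `y ∈ φ.source` has chart image in `L(E × 0)`,
  forcing `r = 0`; the points `f y` with `y ∉ φ.source` form a compact set not containing
  `f x₀`, missed by the segment for `|r| < δ`.  Reparametrising `(-δ, δ)` by
  `r = (2δ/π) arctan s` gives the arc on all of `ℝ`.
* `exists_dualCircle_of_isSmoothEmbedding` — **dual circles.**  If moreover `N` is a compact
  `m`-manifold modelled on `ℝᵐ`, `m ≥ 3`, and the complement of `f(M)` is connected, then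
  through every point `f x₀` there is a smoothly embedded circle `e : S¹ → N` meeting `f(M)` in
  exactly one point `e s₀ = f x₀`, and coinciding near that point with a normal arc (so that the
  intersection is transverse): the complement is open and connected, hence path connected, and
  the normal arc closes up through it by `Milnor1965_exists_embedding_circle_through_arc_holds`.
  For `N = S¹ × Sⁿ` (re-charted on `ℝⁿ⁺¹`), `M = Sⁿ`, `n ≥ 2`, this is the dual circle of the
  printed proof.

## References

* R. Budney, D. Gabai, *Knotted 3-balls in `S⁴`*, arXiv:1912.09029 (v2), §3, proof of Thm. 3.13
  (p. 22). [BudneyGabai2019]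
* J. Milnor, *Lectures on the h-cobordism theorem*, Princeton (1965), proof of Lemma 8.3 (PDF
  p. 56), Lemma 6.12. [MilnorHCobordism1965]
* J. M. Lee, *Introduction to Smooth Manifolds*, 2nd ed. (2013), Thm. 5.8 / Prop. 5.22 (slice
  charts of embedded submanifolds). [LeeSmoothManifolds2013]
-/

noncomputable section

open scoped Manifold ContDiff Topology Real
open Set Function Metric Module

namespace Literature.Topology.FourManifolds

universe u

section NormalArc

variable {E H : Type*} [NormedAddCommGroup E] [NormedSpace ℝ E] [TopologicalSpace H]
  {E' : Type u} {G : Type*} [NormedAddCommGroup E'] [NormedSpace ℝ E'] [TopologicalSpace G]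
  {I : ModelWithCorners ℝ E H} {J : ModelWithCorners ℝ E' G}
  {M : Type*} [TopologicalSpace M] [ChartedSpace H M]
  {N : Type*} [TopologicalSpace N] [ChartedSpace G N]

/-- The reparametrisation `s ↦ (2δ/π) arctan s` of `ℝ` onto `(-δ, δ)`: smooth, vanishing exactly
at `0`, with image in `(-δ, δ)` and nowhere-vanishing derivative. [folklore] -/
private theorem arctan_reparam {δ : ℝ} (hδ : 0 < δ) :
    ∃ σ : ℝ → ℝ, ContDiff ℝ ∞ σ ∧ Injective σ ∧ σ 0 = 0 ∧ (∀ s, |σ s| < δ) ∧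
      ∃ σ' : ℝ → ℝ, (∀ s, HasDerivAt σ (σ' s) s) ∧ ∀ s, σ' s ≠ 0 := by
  refine ⟨fun s ↦ δ * (2 / π) * Real.arctan s, contDiff_const.mul Real.contDiff_arctan, ?_, ?_,
    ?_, fun s ↦ δ * (2 / π) * (1 / (1 + s ^ 2)), fun s ↦ (Real.hasDerivAt_arctan s).const_mul _,
    fun s ↦ ?_⟩
  · have hc : 0 < δ * (2 / π) := by positivity
    exact (Real.arctan_strictMono.const_mul hc).injective
  · simp
  · intro s
    have h1 := Real.arctan_lt_pi_div_two s
    have h2 := Real.neg_pi_div_two_lt_arctan s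
    have hπ := Real.pi_pos
    rw [abs_lt]
    constructor
    · have : δ * (2 / π) * (-(π / 2)) < δ * (2 / π) * Real.arctan s :=
        mul_lt_mul_of_pos_left h2 (by positivity)
      calc -δ = δ * (2 / π) * (-(π / 2)) := by field_simp
        _ < _ := this
    · have : δ * (2 / π) * Real.arctan s < δ * (2 / π) * (π / 2) :=
        mul_lt_mul_of_pos_left h1 (by positivity)
      calc _ < δ * (2 / π) * (π / 2) := this
        _ = δ := by field_simp
  · positivity

/-- **A normal arc through a point of a compact embedded submanifold of positive codimension.**
Let `f : M → N` be a `C^∞` embedding of a compact manifold `M` into a Hausdorff manifold `N`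
(boundaryless finite-dimensional real models) with `dim M < dim N`.  For every `x₀ ∈ M` there is
a `C^∞` injective immersion `γ : ℝ → N` with `γ 0 = f x₀` which meets `f(M)` only at `s = 0`
and is transverse to `f(M)` there: `dγ₀(1) ∉ df_{x₀}(T_{x₀}M)`.  (In the slice charts of the
immersion at `x₀` — Lee, *Introduction to Smooth Manifolds*, Thm. 5.8 — the arc is a straight
segment in a direction not tangent to the slice, short enough to miss the compact set
`f(M ∖ chart domain)`, reparametrised over `ℝ`.) [folklore] -/
theorem exists_normalArc_of_isSmoothEmbedding
    [FiniteDimensional ℝ E] [FiniteDimensional ℝ E'] [I.Boundaryless] [J.Boundaryless]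
    [CompactSpace M] [T2Space N]
    {f : M → N} (hf : Manifold.IsSmoothEmbedding I J ∞ f)
    (hdim : finrank ℝ E < finrank ℝ E') (x₀ : M) :
    ∃ γ : ℝ → N, ContMDiff 𝓘(ℝ, ℝ) J ∞ γ ∧ Injective γ ∧
      (∀ s, Injective (mfderiv 𝓘(ℝ, ℝ) J γ s)) ∧ γ 0 = f x₀ ∧ (∀ s, s ≠ 0 → γ s ∉ range f) ∧
      (mfderiv 𝓘(ℝ, ℝ) J γ 0 (1 : ℝ) : E') ∉ (mfderiv I J f x₀).range := by
  classical
  -- ### the slice charts of the immersion at `x₀`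
  have h : Manifold.IsImmersionAt I J ∞ f x₀ := hf.isImmersion.isImmersionAt x₀
  set φ := h.domChart with hφdef
  set ψ := h.codChart with hψdef
  set L := h.equiv with hLdef
  have hφ : φ ∈ IsManifold.maximalAtlas I ∞ M := h.domChart_mem_maximalAtlas
  have hψ : ψ ∈ IsManifold.maximalAtlas J ∞ N := h.codChart_mem_maximalAtlas
  have hx₀φ : x₀ ∈ φ.source := h.mem_domChart_source
  have hfx₀ψ : f x₀ ∈ ψ.source := h.mem_codChart_source
  have hwr : ∀ u ∈ (φ.extend I).target,
      ψ.extend J (f ((φ.extend I).symm u)) = L (u, 0) := fun u hu ↦ h.writtenInCharts hu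
  -- chart value at a point of `φ.source`
  have hwr' : ∀ y ∈ φ.source, ψ.extend J (f y) = L (φ.extend I y, 0) := by
    intro y hy
    have hu : φ.extend I y ∈ (φ.extend I).target :=
      (φ.extend I).map_source (by rwa [OpenPartialHomeomorph.extend_source])
    have := hwr _ hu
    rwa [OpenPartialHomeomorph.extend_left_inv _ hy] at this
  set c : E' := ψ.extend J (f x₀) with hcdef
  have hc : c = L (φ.extend I x₀, 0) := hwr' x₀ hx₀φ
  -- ### the tangent slice `S = L(E × 0)` and a direction `v ∉ S`
  set S : Submodule ℝ E' :=
    LinearMap.range ((L : (E × h.complement) →L[ℝ] E').toLinearMap ∘ₗ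
      LinearMap.inl ℝ E h.complement) with hSdef
  have hLS : ∀ a : E, L (a, 0) ∈ S := fun a ↦ ⟨a, rfl⟩
  have hStop : S ≠ ⊤ := by
    intro htop
    have h1 : finrank ℝ S ≤ finrank ℝ E := LinearMap.finrank_range_le _
    rw [htop, finrank_top] at h1
    omega
  obtain ⟨v, hvS⟩ : ∃ v : E', v ∉ S := by
    by_contra hall
    push Not at hall
    exact hStop (Submodule.eq_top_iff'.2 hall)
  have hv0 : v ≠ 0 := fun hv ↦ hvS (hv ▸ S.zero_mem)
  -- `L (u, 0) = c + r • v` forces `r = 0`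
  have hkey : ∀ (u : E) (r : ℝ), L (u, 0) = c + r • v → r = 0 := by
    intro u r hur
    by_contra hr
    apply hvS
    have hmem : r • v ∈ S := by
      have : r • v = L (u, 0) - L (φ.extend I x₀, 0) := by rw [hur, hc]; abel
      rw [this]
      exact S.sub_mem (hLS _) (hLS _)
    rwa [S.smul_mem_iff hr] at hmem
  -- ### the straight segment in the chart and the length `δ`
  have hT : IsOpen (ψ.extend J).target := OpenPartialHomeomorph.isOpen_extend_target _
  have hcT : c ∈ (ψ.extend J).target :=
    (ψ.extend J).map_source (by rwa [OpenPartialHomeomorph.extend_source])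
  set g : E' → N := ⇑(ψ.extend J).symm with hgdef
  have hgc : g c = f x₀ := OpenPartialHomeomorph.extend_left_inv _ hfx₀ψ
  have hgcont : ContinuousAt g c :=
    (OpenPartialHomeomorph.continuousOn_extend_symm _).continuousAt (hT.mem_nhds hcT)
  -- the compact set `f (M ∖ φ.source)` misses `f x₀`
  set C : Set N := f '' φ.sourceᶜ with hCdef
  have hCc : IsCompact C :=
    (φ.open_source.isClosed_compl.isCompact).image hf.contMDiff.continuous
  have hx₀C : f x₀ ∉ C := by
    rintro ⟨y, hy, hyx⟩
    exact hy (hf.isEmbedding.injective hyx ▸ hx₀φ)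
  have hlin : Continuous fun r : ℝ ↦ c + r • v := continuous_const.add (continuous_id.smul
    continuous_const)
  have E1 : ∀ᶠ r in 𝓝 (0 : ℝ), c + r • v ∈ (ψ.extend J).target :=
    hlin.continuousAt.preimage_mem_nhds (by simpa using hT.mem_nhds hcT)
  have E2 : ∀ᶠ r in 𝓝 (0 : ℝ), g (c + r • v) ∈ Cᶜ := by
    have hgl : ContinuousAt (fun r : ℝ ↦ g (c + r • v)) 0 :=
      hgcont.comp_of_eq hlin.continuousAt (by simp)
    refine hgl.preimage_mem_nhds ?_
    have : g (c + (0 : ℝ) • v) = f x₀ := by rw [zero_smul, add_zero, hgc]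
    rw [this]
    exact hCc.isClosed.isOpen_compl.mem_nhds hx₀C
  obtain ⟨δ, hδ, hδp⟩ : ∃ δ > 0, ∀ r : ℝ, |r| < δ →
      c + r • v ∈ (ψ.extend J).target ∧ g (c + r • v) ∉ C := by
    obtain ⟨δ, hδ, hball⟩ := Metric.eventually_nhds_iff.1 (E1.and E2)
    exact ⟨δ, hδ, fun r hr ↦ hball (by rwa [Real.dist_0_eq_abs])⟩
  -- ### the reparametrised arc `γ s = ψ⁻¹ (c + σ s • v)`
  obtain ⟨σ, hσs, hσinj, hσ0, hσδ, σ', hσ', hσ'0⟩ := arctan_reparam hδ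
  have hσz : ∀ s, σ s = 0 → s = 0 := fun s hs ↦ hσinj (hs.trans hσ0.symm)
  set ℓ : ℝ → E' := fun s ↦ c + σ s • v with hℓdef
  have hℓT : ∀ s, ℓ s ∈ (ψ.extend J).target := fun s ↦ (hδp _ (hσδ s)).1
  have hℓC : ∀ s, g (ℓ s) ∉ C := fun s ↦ (hδp _ (hσδ s)).2
  have hℓs : ContDiff ℝ ∞ ℓ := contDiff_const.add (hσs.smul contDiff_const)
  have hℓd : ∀ s, HasDerivAt ℓ (σ' s • v) s := fun s ↦
    ((hσ' s).smul_const v).const_add c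
  set γ : ℝ → N := fun s ↦ g (ℓ s) with hγdef
  have hψγ : ∀ s, ψ.extend J (γ s) = ℓ s := fun s ↦ (ψ.extend J).right_inv (hℓT s)
  have hγsrc : ∀ s, γ s ∈ ψ.source := fun s ↦ by
    have := (ψ.extend J).map_target (hℓT s)
    rwa [OpenPartialHomeomorph.extend_source] at this
  have hcomp : (ψ.extend J) ∘ γ = ℓ := funext hψγ
  -- smoothness
  have hgs : ContMDiffOn 𝓘(ℝ, E') J ∞ g (ψ.extend J).target := by
    rw [OpenPartialHomeomorph.extend_target']
    exact contMDiffOn_extend_symm hψ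
  have hγ : ContMDiff 𝓘(ℝ, ℝ) J ∞ γ := hgs.comp_contMDiff hℓs.contMDiff hℓT
  -- the differential of the chart along `γ`, and the chain rule `dψ ∘ dγ = dℓ`
  have hA : ∀ s, MDifferentiableAt J 𝓘(ℝ, E') (ψ.extend J) (γ s) := fun s ↦
    ((OpenPartialHomeomorph.contMDiffOn_extend hψ).contMDiffAt
      (ψ.open_source.mem_nhds (hγsrc s))).mdifferentiableAt (by simp)
  have hchain : ∀ s, mfderiv 𝓘(ℝ, ℝ) 𝓘(ℝ, E') ℓ s =
      (mfderiv J 𝓘(ℝ, E') (ψ.extend J) (γ s)).comp (mfderiv 𝓘(ℝ, ℝ) J γ s) := fun s ↦ by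
    rw [← hcomp]
    exact mfderiv_comp s (hA s) ((hγ s).mdifferentiableAt (by simp))
  have hℓmf : ∀ s, mfderiv 𝓘(ℝ, ℝ) 𝓘(ℝ, E') ℓ s =
      ContinuousLinearMap.smulRight (1 : ℝ →L[ℝ] ℝ) (σ' s • v) := fun s ↦ by
    rw [mfderiv_eq_fderiv]
    exact (hℓd s).hasFDerivAt.fderiv
  refine ⟨γ, hγ, ?_, fun s ↦ ?_, by simp [hγdef, hℓdef, hσ0, hgc], fun s hs ↦ ?_, ?_⟩
  · -- ### injectivity
    intro s s' hss'
    have h1 : ℓ s = ℓ s' := by rw [← hψγ, ← hψγ, hss']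
    have h2 : σ s • v = σ s' • v := add_left_cancel h1
    exact hσinj (smul_left_injective ℝ hv0 h2)
  · -- ### immersion
    have hinjℓ : Injective (mfderiv 𝓘(ℝ, ℝ) 𝓘(ℝ, E') ℓ s) := by
      rw [hℓmf]
      intro (a : ℝ) (b : ℝ) hab
      have hab' : a • (σ' s • v) = b • (σ' s • v) := hab
      exact smul_left_injective ℝ (smul_ne_zero (hσ'0 s) hv0) hab'
    rw [hchain s] at hinjℓ
    have key : Injective (⇑(mfderiv J 𝓘(ℝ, E') (ψ.extend J) (γ s)) ∘
        ⇑(mfderiv 𝓘(ℝ, ℝ) J γ s)) := hinjℓ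
    exact key.of_comp
  · -- ### the arc meets `f(M)` only at `s = 0`
    rintro ⟨y, hy⟩
    by_cases hyφ : y ∈ φ.source
    · have h1 : ψ.extend J (f y) = L (φ.extend I y, 0) := hwr' y hyφ
      rw [hy, hψγ] at h1
      exact hs (hσz s (hkey _ _ h1.symm))
    · have hyC : f y ∈ C := mem_image_of_mem f hyφ
      rw [hy] at hyC
      exact hℓC s hyC
  · -- ### transversality at `s = 0`
    rintro ⟨ξ, hξ⟩
    have hξ' : mfderiv I J f x₀ ξ = mfderiv 𝓘(ℝ, ℝ) J γ 0 (1 : ℝ) := hξ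
    have hγ0 : γ 0 = f x₀ := by simp [hγdef, hℓdef, hσ0, hgc]
    -- `dψ (dγ 1) = σ' 0 • v`
    have hAγ : (mfderiv J 𝓘(ℝ, E') (ψ.extend J) (γ 0)) (mfderiv 𝓘(ℝ, ℝ) J γ 0 (1 : ℝ)) =
        σ' 0 • v := by
      have h1 := congrArg (fun T : ℝ →L[ℝ] E' ↦ T 1) ((hchain 0).symm.trans (hℓmf 0))
      have h2 : (mfderiv J 𝓘(ℝ, E') (ψ.extend J) (γ 0)) (mfderiv 𝓘(ℝ, ℝ) J γ 0 (1 : ℝ)) =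
          (1 : ℝ) • (σ' 0 • v) := h1
      rw [one_smul] at h2
      exact h2
    -- `dψ ∘ df` takes values in the slice `S`
    set Lc : E →L[ℝ] E' :=
      (L : (E × h.complement) →L[ℝ] E').comp (ContinuousLinearMap.inl ℝ E h.complement)
      with hLcdef
    have hLc : ∀ a : E, Lc a = L (a, 0) := fun a ↦ rfl
    have hloc : (ψ.extend J) ∘ f =ᶠ[𝓝 x₀] Lc ∘ (φ.extend I) := by
      filter_upwards [φ.open_source.mem_nhds hx₀φ] with y hy
      simp only [comp_apply, hLc]
      exact hwr' y hy
    have hφd : MDifferentiableAt I 𝓘(ℝ, E) (φ.extend I) x₀ :=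
      ((OpenPartialHomeomorph.contMDiffOn_extend hφ).contMDiffAt
        (φ.open_source.mem_nhds hx₀φ)).mdifferentiableAt (by simp)
    have hfd : MDifferentiableAt I J f x₀ := hf.contMDiff.mdifferentiableAt (by simp)
    have hA0 : MDifferentiableAt J 𝓘(ℝ, E') (ψ.extend J) (f x₀) :=
      ((OpenPartialHomeomorph.contMDiffOn_extend hψ).contMDiffAt
        (ψ.open_source.mem_nhds hfx₀ψ)).mdifferentiableAt (by simp)
    have hD1 : mfderiv I 𝓘(ℝ, E') ((ψ.extend J) ∘ f) x₀ =
        (mfderiv J 𝓘(ℝ, E') (ψ.extend J) (f x₀)).comp (mfderiv I J f x₀) :=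
      mfderiv_comp x₀ hA0 hfd
    have hD2 : mfderiv I 𝓘(ℝ, E') (Lc ∘ (φ.extend I)) x₀ =
        Lc.comp (mfderiv I 𝓘(ℝ, E) (φ.extend I) x₀) := by
      have h1 : HasMFDerivAt 𝓘(ℝ, E) 𝓘(ℝ, E') Lc (φ.extend I x₀) Lc :=
        Lc.hasFDerivAt.hasMFDerivAt
      exact (h1.comp x₀ hφd.hasMFDerivAt).mfderiv
    have hD : (mfderiv J 𝓘(ℝ, E') (ψ.extend J) (f x₀)).comp (mfderiv I J f x₀) =
        Lc.comp (mfderiv I 𝓘(ℝ, E) (φ.extend I) x₀) := by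
      rw [← hD1, hloc.mfderiv_eq, hD2]
    have hSf : (mfderiv J 𝓘(ℝ, E') (ψ.extend J) (f x₀)) (mfderiv I J f x₀ ξ) ∈ S := by
      have h1 := congrArg (fun T : TangentSpace I x₀ →L[ℝ] E' ↦ T ξ) hD
      have h2 : (mfderiv J 𝓘(ℝ, E') (ψ.extend J) (f x₀)) (mfderiv I J f x₀ ξ) =
          Lc (mfderiv I 𝓘(ℝ, E) (φ.extend I) x₀ ξ) := h1
      rw [h2, hLc]
      exact hLS _
    -- compare the two chart differentials at the point `γ 0 = f x₀`
    have hAeq : ∀ w : E', (mfderiv J 𝓘(ℝ, E') (ψ.extend J) (γ 0)) w =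
        (mfderiv J 𝓘(ℝ, E') (ψ.extend J) (f x₀)) w := by
      intro w
      rw [hγ0]
    have h3 : (mfderiv J 𝓘(ℝ, E') (ψ.extend J) (f x₀)) (mfderiv I J f x₀ ξ) = σ' 0 • v := by
      rw [hξ', ← hAeq]
      exact hAγ
    rw [h3] at hSf
    exact hvS ((S.smul_mem_iff (hσ'0 0)).1 hSf)

end NormalArc

section DualCircle

variable {E H : Type*} [NormedAddCommGroup E] [NormedSpace ℝ E] [TopologicalSpace H]
  {I : ModelWithCorners ℝ E H} {M : Type*} [TopologicalSpace M] [ChartedSpace H M]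

/-- **Dual circles to a compact embedded submanifold of codimension `≥ 1` with connected
complement** (the first step of the proof of Budney–Gabai Thm. 3.13, p. 22: *"complementary to a
non-separating sphere there is an embedding `S¹ → S¹ × Sⁿ` that intersects the sphere precisely
once and transversely"*).  Let `N` be a compact `m`-manifold modelled on `ℝᵐ`, `m ≥ 3`, and
`f : M → N` a `C^∞` embedding of a compact manifold of smaller dimension whose image has
connected complement.  Through every point `f x₀` there is a smoothly embedded circle
`e : S¹ → N` meeting `f(M)` exactly in `e s₀ = f x₀`, which near `f x₀` is the normal arc `γ` of
`exists_normalArc_of_isSmoothEmbedding` (an injective immersion with `γ 0 = f x₀` and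
`γ'(0) ∉ df_{x₀}(T_{x₀}M)`, so that the circle crosses `f(M)` transversally).  Proof: the
complement of `f(M)` is open and connected, hence path connected, and the normal arc closes up
through it by the tree's `Milnor1965_exists_embedding_circle_through_arc_holds` (Milnor 1965,
proof of Lemma 8.3, with Whitney's Lemma 6.12). [cite: BudneyGabai2019, proof of Thm. 3.13]
[cite: MilnorHCobordism1965, proof of Lemma 8.3 (PDF p. 56)] -/
theorem exists_dualCircle_of_isSmoothEmbedding {m : ℕ} (hm : 3 ≤ m)
    {N : Type u} [TopologicalSpace N] [T2Space N] [SecondCountableTopology N] [CompactSpace N]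
    [ChartedSpace (EuclideanSpace ℝ (Fin m)) N] [IsManifold (𝓡 m) ∞ N]
    [FiniteDimensional ℝ E] [I.Boundaryless] [CompactSpace M]
    {f : M → N} (hf : Manifold.IsSmoothEmbedding I (𝓡 m) ∞ f) (hdim : finrank ℝ E < m)
    (hconn : IsConnected (range f)ᶜ) (x₀ : M) :
    ∃ e : Metric.sphere (0 : EuclideanSpace ℝ (Fin 2)) 1 → N,
      Manifold.IsSmoothEmbedding (𝓡 1) (𝓡 m) ∞ e ∧
      ∃ s₀, e s₀ = f x₀ ∧ (∀ s, s ≠ s₀ → e s ∉ range f) ∧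
      ∃ γ : ℝ → N, ContMDiff 𝓘(ℝ, ℝ) (𝓡 m) ∞ γ ∧ Injective γ ∧
        (∀ s, Injective (mfderiv 𝓘(ℝ, ℝ) (𝓡 m) γ s)) ∧ γ 0 = f x₀ ∧
        (∀ s, s ≠ 0 → γ s ∉ range f) ∧
        (mfderiv 𝓘(ℝ, ℝ) (𝓡 m) γ 0 (1 : ℝ) : EuclideanSpace ℝ (Fin m)) ∉
          (mfderiv I (𝓡 m) f x₀).range ∧
        ∃ U ∈ 𝓝 (f x₀), range e ∩ U = γ '' Icc (-1) 1 ∩ U := by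
  obtain ⟨γ, hγs, hγinj, hγimm, hγ0, hγoff, hγtr⟩ :=
    exists_normalArc_of_isSmoothEmbedding hf (by simpa using hdim) x₀
  have hO : IsOpen (range f)ᶜ :=
    (isCompact_range hf.contMDiff.continuous).isClosed.isOpen_compl
  haveI : LocallyPathConnectedSpace N :=
    ChartedSpace.locallyPathConnectedSpace (EuclideanSpace ℝ (Fin m)) N
  have hOpc : IsPathConnected (range f)ᶜ := hO.isConnected_iff_isPathConnected.1 hconn
  obtain ⟨e, he, s₀, hs₀, heO, U, hU, hUeq⟩ :=
    Milnor1965_exists_embedding_circle_through_arc_holds hm hO hOpc γ hγs hγinj hγimm hγoff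
  refine ⟨e, he, s₀, hs₀.trans hγ0, fun s hs ↦ heO s hs, γ, hγs, hγinj, hγimm, hγ0, hγoff,
    hγtr, U, ?_, hUeq⟩
  rwa [hγ0] at hU

end DualCircle

end Literature.Topology.FourManifolds

end
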